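import Summits.Ventures.CertifiedManyBodySolver.Observables.PairKernelCeilingTL
import Summits.Ventures.CertifiedManyBodySolver.Observables.PairLROTorusDictionary
import Literature.MathematicalPhysics.QuantumLattice.PairFieldWeightedAverageBound
import Summits.Ventures.CertifiedManyBodySolver.Rows.DopedTLCorr
import HarnessLib

/-!
# The kernel pair word on the finite tori: dictionary, KINEMATIC domination
# `(Σ Q) · L⁻⁴ Re⟨ψ, Δ_d† Δ_d ψ⟩ ≤ Re ω̄_ψ(Γ(ι) pairKernelWord B Q)` for Gram taps, and the ceiling on the
# `liminf` of `HubbardSuperconductivity`'s pair-field LRO sequence from a thermodynamic-limit row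

HONEST FRAMING: first certified bounds on pairing observables; not a superconductivity verdict; every
number certified (two lineages + referee) or labelled float. Crew hubbard-obs (D-0042), seat hubbard-obs-p1
(`prover-hubbard-obs-p1-g2-0`), lead ruling (af2). Theorem-only; zero compute; no named fact; no `sorry`.

The kernel twin of `Observables/PairLROTorusDictionary.lean` + `PairLROTorusCeilingRow.lean` (box word,
unit taps): for rational taps `Q` with an exact GRAM presentation on `B` (`Q x y = Σ_k w_k v_k x v_k y`,
`w_k ≥ 0` — the form in which a kernel certificate ships its taps, and which makes `Q ⪰ 0` kernel-checkable),

* §1 `fermionEmbed_toTorusEmb_pairKernelWord` — `Γ(ι_{Λ_B,L})(pairKernelWord B Q) = Σ_{x,y∈B} Q x y • (Δ^L_x̄)† Δ^L_ȳ`,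
  and `re_orbitState_pairKernelWord_eq` — `Re ω̄_ψ(Γ(ι) pairKernelWord B Q) =
  (L²|S|)⁻¹ Σ_{γ∈S} Σ_{x,y∈B} Q x y Σ_z Re⟨ψ, Δ_z† Δ_{z+γ(ȳ−x̄)} ψ⟩` (`S ∋ 1`);
* §2 KINEMATIC (every vector `ψ`): by the weighted torus box-average bound
  (`pairField_gramSum_mul_re_expect_le`, Literature `PairFieldWeightedAverageBound`) on each rotated
  placement `x ↦ γx̄`, **`(Σ_{x,y∈B} Q x y) · L⁻⁴ Re⟨ψ, Δ_d† Δ_d ψ⟩ ≤ Re ω̄_ψ(Γ(ι_{Λ_B,L}) pairKernelWord B Q)`**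
  (`gramSum_mul_pairFieldDensity_le_re_orbitState_pairKernelWord`);
* §3 from an ORBIT LOWER row on the NEGATED kernel word, `SquareTTPrimeCorrOrbitLowerRow tp U n u r S Λ_B
  (−pairKernelWord B Q)` (`S ∋ 1`), the cap `energyDensityTT' 1 tp U n ≤ u` and ANY family `ψ_L` of unit
  sector ground states: **`liminf_k u_k ≤ −r / Σ Q`** for the summit's sequence
  `u_k = |Λ_{2k}|⁻² Σ_{x,y} P_d(2k; x, y)` (`liminf_dWavePairFieldLRO_le_of_kernel_orbitLowerRow_neg`;
  compactness + row at the limit + convergence of the rotated words + §1–§2, verbatim the box proof);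
  plain UPPER row and M3′ corollaries.
HONEST: a certified CEILING on the summit's LRO sequence at one `(U, n, t′)`; neither proves nor refutes the
summit; no number lives in this file.
-/

noncomputable section

namespace Summit.Ventures.CertifiedManyBodySolver.Observables

open Matrix Finset Literature.MathematicalPhysics.QuantumLattice Literature.Probability.LatticeModels
open Literature.MathematicalPhysics.QuantumLattice.HubbardWave0 ThermodynamicLimit Filter Topology
open Literature.MathematicalPhysics.QuantumManyBody.StateRelaxation
open scoped ComplexOrder BigOperators

/-! ## §1  Torus dictionary for the kernel pair word -/

section Dictionary

variable {L : ℕ} [NeZero L]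

/-- (Local to this section, as in the tree's pair-correlator files.) [folklore] -/
local instance (priority := high) instDecidableEqFermionTorusPairKernelLRO : DecidableEq (FermionTorus 2 L) :=
  LinearOrder.toDecidableEq

/-- **Pull-back of the kernel pair word**: `Γ(ι_{Λ_B,L})(pairKernelWord S g B Q) = Σ_{x,y∈B} Q x y • (Δ^L_x̄)† Δ^L_ȳ`
with the torus pairs `localPairOn S g L` (`x̄ = x mod L`). [cite: Scalapino1995, §2 eq. (2.4)] -/
theorem fermionEmbed_toTorusEmb_pairKernelWord (S : Finset (Site 2)) (g : Site 2 → ℝ) (B : Finset (Site 2))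
    (Q : Site 2 → Site 2 → ℚ) (hInj : Set.InjOn (Torus.proj (d := 2) L) ↑(B.biUnion (pairRegion S))) :
    fermionEmbed (PolySite.toTorusEmb L hInj) (pairKernelWord S g B Q) =
      ∑ x ∈ B, ∑ y ∈ B, (((Q x y : ℚ) : ℝ) : ℂ) •
        ((localPairOn S g L (Torus.proj L x))ᴴ * localPairOn S g L (Torus.proj L y)) := by
  unfold pairKernelWord
  rw [fermionEmbed_sum, ← Finset.sum_attach B (fun x => ∑ y ∈ B, (((Q x y : ℚ) : ℝ) : ℂ) •
    ((localPairOn S g L (Torus.proj L x))ᴴ * localPairOn S g L (Torus.proj L y)))]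
  refine Finset.sum_congr rfl fun x _ => ?_
  rw [fermionEmbed_sum, ← Finset.sum_attach B (fun y => (((Q x y : ℚ) : ℝ) : ℂ) •
    ((localPairOn S g L (Torus.proj L (x : Site 2)))ᴴ * localPairOn S g L (Torus.proj L y)))]
  refine Finset.sum_congr rfl fun y _ => ?_
  rw [fermionEmbed_smul, fermionEmbed_mul, fermionEmbed_toTorusEmb_incl, fermionEmbed_toTorusEmb_incl,
    fermionEmbed_conjTranspose, fermionEmbed_toTorusEmb_localPairAt, fermionEmbed_toTorusEmb_localPairAt]

/-- **The orbit-state value of the `d`-wave kernel pair word on the torus**: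
`Re ω̄_ψ(Γ(ι) pairKernelWord B Q) = (Σ_{γ∈S} Σ_{x,y∈B} Q x y Σ_z Re⟨ψ, Δ_z† Δ_{z+γ(ȳ−x̄)} ψ⟩) / (L² |S|)`
(`ω̄_ψ = orbitState (spaceGroupUnitary S) ψ`, `S ∋ 1`). [cite: Han2020Bootstrap, §2 eq. (2)] -/
theorem re_orbitState_pairKernelWord_eq {S : Finset (DihedralGroup 4)} (h1 : (1 : DihedralGroup 4) ∈ S)
    (B : Finset (Site 2)) (Q : Site 2 → Site 2 → ℚ)
    (hInj : Set.InjOn (Torus.proj (d := 2) L) ↑(B.biUnion (pairRegion (insert (0 : Site 2) unitSteps))))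
    (ψ : Fock (Orb (FermionTorus 2 L))) :
    (orbitState (spaceGroupUnitary S) ψ
        (fermionEmbed (PolySite.toTorusEmb L hInj)
          (pairKernelWord (insert (0 : Site 2) unitSteps) dWaveFormFactor B Q))).re =
      (∑ γ ∈ S, ∑ x ∈ B, ∑ y ∈ B, ((Q x y : ℚ) : ℝ) * ∑ z : TorusSite 2 L,
        (expect ((localPair dWaveFormFactor L z)ᴴ *
          localPair dWaveFormFactor L (z + d4Site γ (Torus.proj L y - Torus.proj L x))) ψ).re) /
        ((L : ℝ) ^ 2 * S.card) := by
  have hLr : ((L : ℝ)) ^ 2 * S.card ≠ 0 :=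
    mul_ne_zero (pow_ne_zero 2 (Nat.cast_ne_zero.2 (NeZero.ne L)))
      (Nat.cast_ne_zero.2 (Finset.card_ne_zero.2 ⟨1, h1⟩))
  set X := fermionEmbed (PolySite.toTorusEmb L hInj)
    (pairKernelWord (insert (0 : Site 2) unitSteps) dWaveFormFactor B Q) with hX
  -- the space-group sum of the pulled-back kernel word
  have hsum : ∑ gg : TorusSite 2 L × ↥S, spaceGroupUnitary S gg * X * (spaceGroupUnitary S gg)ᴴ =
      ∑ x ∈ B, ∑ y ∈ B, (((Q x y : ℚ) : ℝ) : ℂ) • ∑ γ ∈ S, ∑ z : TorusSite 2 L,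
        (localPair dWaveFormFactor L z)ᴴ *
          localPair dWaveFormFactor L (z + d4Site γ (Torus.proj L y - Torus.proj L x)) := by
    rw [hX, fermionEmbed_toTorusEmb_pairKernelWord]
    simp_rw [localPairOn_insert_zero_unitSteps, Finset.mul_sum, Finset.sum_mul, Matrix.mul_smul,
      Matrix.smul_mul]
    rw [Finset.sum_comm]
    refine Finset.sum_congr rfl fun x _ => ?_
    rw [Finset.sum_comm]
    refine Finset.sum_congr rfl fun y _ => ?_
    rw [← Finset.smul_sum, sum_spaceGroupUnitary_conj_localPair_corr' S dWaveFormFactor b1gSign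
      (fun γ _ => b1gSign_mul_self γ) (fun γ _ e => dWaveFormFactor_d4Vec_eq_b1gSign_mul γ e)]
  have h := star_dotProduct_sum_spaceGroup_conj_mulVec h1 ψ X
  rw [hsum] at h
  simp only [Matrix.sum_mulVec, dotProduct_sum, Matrix.smul_mulVec, dotProduct_smul, smul_eq_mul] at h
  -- real parts: the scalar sum, reordered to `Σ_γ Σ_x Σ_y`
  have hre : (∑ γ ∈ S, ∑ x ∈ B, ∑ y ∈ B, ((Q x y : ℚ) : ℝ) * ∑ z : TorusSite 2 L,
      (expect ((localPair dWaveFormFactor L z)ᴴ *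
        localPair dWaveFormFactor L (z + d4Site γ (Torus.proj L y - Torus.proj L x))) ψ).re) =
      (∑ x ∈ B, ∑ y ∈ B, (((Q x y : ℚ) : ℝ) : ℂ) * ∑ γ ∈ S, ∑ z : TorusSite 2 L,
        star ψ ⬝ᵥ (((localPair dWaveFormFactor L z)ᴴ *
          localPair dWaveFormFactor L (z + d4Site γ (Torus.proj L y - Torus.proj L x))) *ᵥ ψ)).re := by
    rw [Complex.re_sum, Finset.sum_comm]
    refine Finset.sum_congr rfl fun x _ => ?_
    rw [Complex.re_sum, Finset.sum_comm]
    refine Finset.sum_congr rfl fun y _ => ?_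
    rw [← Finset.mul_sum, Complex.re_ofReal_mul, Complex.re_sum]
    refine congrArg₂ (· * ·) rfl ?_
    refine Finset.sum_congr rfl fun γ _ => ?_
    rw [Complex.re_sum]
    rfl
  rw [hre, h]
  have hc : ((L ^ 2 * S.card : ℕ) : ℂ) = ((((L : ℝ)) ^ 2 * S.card : ℝ) : ℂ) := by push_cast; ring
  rw [hc, Complex.re_ofReal_mul, mul_div_cancel_left₀ _ hLr]

end Dictionary

/-! ## §2  Kinematics: the orbit-averaged kernel functional dominates `(Σ Q) ×` the pair-field density -/

section Kinematic

variable {L : ℕ} [NeZero L]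

/-- (Local to this section.) [folklore] -/
local instance (priority := high) instDecidableEqFermionTorusPairKernelLRO' : DecidableEq (FermionTorus 2 L) :=
  LinearOrder.toDecidableEq

/-- **Weighted box average on a rotated placement**: for every `γ ∈ D₄`, every window `B ⊆ ℤ²`, Gram taps
`Q x y = Σ_k w_k v_k x v_k y` (`w_k ≥ 0`) and every torus vector `ψ`,
`(Σ_{x,y∈B} Q x y) · Re⟨ψ, Δ_g† Δ_g ψ⟩ ≤ L² · Σ_{x,y∈B} Q x y Σ_z Re⟨ψ, Δ_z† Δ_{z+γ(ȳ−x̄)} ψ⟩` — the Literature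
bound `pairField_gramSum_mul_re_expect_le` for the placement `x ↦ γ x̄`. [cite: Scalapino1995, §2] -/
theorem gramSum_mul_re_expect_pairField_le_sum_d4 (g : Site 2 → ℝ) (γ : DihedralGroup 4) (B : Finset (Site 2))
    {K' : Type*} (K : Finset K') (wt : K' → ℝ) (v : K' → Site 2 → ℝ) (hw : ∀ k ∈ K, 0 ≤ wt k)
    (Q : Site 2 → Site 2 → ℝ) (hQ : ∀ x ∈ B, ∀ y ∈ B, Q x y = ∑ k ∈ K, wt k * v k x * v k y)
    (ψ : Fock (Orb (FermionTorus 2 L))) :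
    (∑ x ∈ B, ∑ y ∈ B, Q x y) * (expect ((pairField g L)ᴴ * pairField g L) ψ).re ≤
      (L : ℝ) ^ 2 * ∑ x ∈ B, ∑ y ∈ B, Q x y * ∑ z : TorusSite 2 L,
        (expect ((localPair g L z)ᴴ * localPair g L (z + d4Site γ (Torus.proj L y - Torus.proj L x))) ψ).re := by
  have h := pairField_gramSum_mul_re_expect_le g L B (fun x => d4Site γ (Torus.proj L x)) K wt v hw Q hQ ψ
  simp_rw [← d4Site_sub'] at h
  exact h

/-- **KINEMATIC DOMINATION (every torus vector, kernel word).** For `S ∋ 1`, every window `B` fitting the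
torus (`x ↦ x mod L` injective on `⋃_{x∈B} pairRegion S_d x`), rational taps `Q` with a Gram presentation on `B`
(`Q x y = Σ_k w_k v_k x v_k y`, `w_k ≥ 0`) and every `ψ`:
`(Σ_{x,y∈B} Q x y) · L⁻⁴ · Re⟨ψ, Δ_d† Δ_d ψ⟩ ≤ Re ω̄_ψ(Γ(ι_{Λ_B,L}) pairKernelWord B Q)`. [cite: Yang1962, §3] -/
theorem gramSum_mul_pairFieldDensity_le_re_orbitState_pairKernelWord {S : Finset (DihedralGroup 4)}
    (h1 : (1 : DihedralGroup 4) ∈ S) (B : Finset (Site 2)) (Q : Site 2 → Site 2 → ℚ)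
    {K' : Type*} (K : Finset K') (wt : K' → ℝ) (v : K' → Site 2 → ℝ) (hw : ∀ k ∈ K, 0 ≤ wt k)
    (hQ : ∀ x ∈ B, ∀ y ∈ B, ((Q x y : ℚ) : ℝ) = ∑ k ∈ K, wt k * v k x * v k y)
    (hInj : Set.InjOn (Torus.proj (d := 2) L) ↑(B.biUnion (pairRegion (insert (0 : Site 2) unitSteps))))
    (ψ : Fock (Orb (FermionTorus 2 L))) :
    (∑ x ∈ B, ∑ y ∈ B, ((Q x y : ℚ) : ℝ)) *
        ((expect ((pairField dWaveFormFactor L)ᴴ * pairField dWaveFormFactor L) ψ).re / (L : ℝ) ^ 4) ≤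
      (orbitState (spaceGroupUnitary S) ψ
        (fermionEmbed (PolySite.toTorusEmb L hInj)
          (pairKernelWord (insert (0 : Site 2) unitSteps) dWaveFormFactor B Q))).re := by
  have hL : (0 : ℝ) < (L : ℝ) := by exact_mod_cast Nat.pos_of_ne_zero (NeZero.ne L)
  have hS : (0 : ℝ) < (S.card : ℝ) := by exact_mod_cast Finset.card_pos.2 ⟨1, h1⟩
  rw [re_orbitState_pairKernelWord_eq h1 B Q hInj ψ, le_div_iff₀ (by positivity)]
  -- sum the rotated-placement bounds over `γ ∈ S`
  have hsum := Finset.sum_le_sum fun γ (_ : γ ∈ S) =>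
    gramSum_mul_re_expect_pairField_le_sum_d4 dWaveFormFactor γ B K wt v hw (fun x y => ((Q x y : ℚ) : ℝ)) hQ ψ
  beta_reduce at hsum
  rw [Finset.sum_const, nsmul_eq_mul, ← Finset.mul_sum] at hsum
  have hL2 : (0 : ℝ) < (L : ℝ) ^ 2 := by positivity
  set E : ℝ := (expect ((pairField dWaveFormFactor L)ᴴ * pairField dWaveFormFactor L) ψ).re with hE
  set q : ℝ := ∑ x ∈ B, ∑ y ∈ B, ((Q x y : ℚ) : ℝ) with hq
  have hrew : q * (E / (L : ℝ) ^ 4) * ((L : ℝ) ^ 2 * S.card) = ((S.card : ℝ) * (q * E)) / (L : ℝ) ^ 2 := by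
    field_simp
  rw [hrew, div_le_iff₀ hL2]
  linarith [hsum]

end Kinematic

/-! ## §3  TL row on `−pairKernelWord` ⇒ ceiling on the `liminf` of the summit's pair-field LRO sequence -/

section Row

/-- **ORBIT row on `−pairKernelWord B Q` ⇒ ceiling on the `liminf` of the summit's pair-field LRO
sequence.** Taps with a Gram presentation and `0 < Σ Q`; see the module docstring.
[cite: Scalapino1995, §2 eq. (2.4)] -/
theorem liminf_dWavePairFieldLRO_le_of_kernel_orbitLowerRow_neg {tp U n : ℝ} {u r : ℚ}
    {S : Finset (DihedralGroup 4)} (h1 : (1 : DihedralGroup 4) ∈ S) {B : Finset (Site 2)}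
    {Q : Site 2 → Site 2 → ℚ} {K' : Type*} (K : Finset K') (wt : K' → ℝ) (v : K' → Site 2 → ℝ)
    (hw : ∀ k ∈ K, 0 ≤ wt k) (hQ : ∀ x ∈ B, ∀ y ∈ B, ((Q x y : ℚ) : ℝ) = ∑ k ∈ K, wt k * v k x * v k y)
    (hQpos : 0 < ∑ x ∈ B, ∑ y ∈ B, ((Q x y : ℚ) : ℝ))
    (hrow : SquareTTPrimeCorrOrbitLowerRow tp U n u r S (B.biUnion (pairRegion (insert (0 : Site 2) unitSteps)))
      (-pairKernelWord (insert (0 : Site 2) unitSteps) dWaveFormFactor B Q))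
    (hu : energyDensityTT' 1 tp U n ≤ ((u : ℚ) : ℝ))
    (ψ : ∀ L, Fock (Orb (FermionTorus 2 L)))
    (hψ : ∀ L, IsGroundStateInSector (hubbardTorusTT' L 1 tp U) (rectN n L) 0 (ψ L))
    (hψ1 : ∀ L, star (ψ L) ⬝ᵥ ψ L = 1) :
    liminf (fun k : ℕ => (∑ x ∈ halfOpenBox 2 (2 * k), ∑ y ∈ halfOpenBox 2 (2 * k),
        torusPullback (pairFieldCorr dWaveFormFactor ψ) (2 * k) x y) /
          ((#(halfOpenBox 2 (2 * k)) : ℝ)) ^ 2) atTop ≤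
      -((r : ℚ) : ℝ) / ∑ x ∈ B, ∑ y ∈ B, ((Q x y : ℚ) : ℝ) := by
  set Λ' : Finset (Site 2) := B.biUnion (pairRegion (insert (0 : Site 2) unitSteps)) with hΛ'
  set X : FermionOp Λ' := pairKernelWord (insert (0 : Site 2) unitSteps) dWaveFormFactor B Q with hX
  set qs : ℝ := ∑ x ∈ B, ∑ y ∈ B, ((Q x y : ℚ) : ℝ) with hqs
  set C : ℝ := -((r : ℚ) : ℝ) / qs with hC
  set useq : ℕ → ℝ := fun k => (∑ x ∈ halfOpenBox 2 (2 * k), ∑ y ∈ halfOpenBox 2 (2 * k),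
      torusPullback (pairFieldCorr dWaveFormFactor ψ) (2 * k) x y) /
        ((#(halfOpenBox 2 (2 * k)) : ℝ)) ^ 2 with huseq
  change liminf useq atTop ≤ C
  have hSpos : 0 < (S.card : ℝ) := by exact_mod_cast Finset.card_pos.2 ⟨1, h1⟩
  -- the `k`-th term (for `k ≥ 1`) is the pair-field density of `ψ_{2k}` (`2k = m + 1`)
  have hterm : ∀ k : ℕ, 1 ≤ k → ∃ m : ℕ, 2 * k = m + 1 ∧
      useq k = (expect ((pairField dWaveFormFactor (m + 1))ᴴ * pairField dWaveFormFactor (m + 1)) (ψ (m + 1))).re /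
        (((m + 1 : ℕ) : ℝ)) ^ 4 := by
    intro k hk
    refine ⟨2 * k - 1, by omega, ?_⟩
    have e : 2 * k = (2 * k - 1) + 1 := by omega
    simp only [huseq]
    rw [e, torusLROSeq_pairFieldCorr_succ]
    rfl
  have hnonneg : ∀ k : ℕ, 1 ≤ k → 0 ≤ useq k := by
    intro k hk
    obtain ⟨m, -, hm⟩ := hterm k hk
    rw [hm]
    refine div_nonneg ?_ (by positivity)
    exact (posSemidef_conjTranspose_mul_self (pairField dWaveFormFactor (m + 1))).re_dotProduct_nonneg (ψ (m + 1))
  have hbdd : IsBoundedUnder (· ≥ ·) atTop useq :=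
    isBoundedUnder_of_eventually_ge (a := 0) (Filter.eventually_atTop.2 ⟨1, fun k hk => hnonneg k hk⟩)
  -- compactness along the even sides: a torus limit `ω` along `2 φ(j)`
  have hL2 : Tendsto (fun k : ℕ => 2 * k) atTop atTop := Filter.tendsto_id.const_mul_atTop' (by norm_num)
  obtain ⟨φ, hφ, ω, hω⟩ := InfVolFermionState.exists_isTorusLimitOf_subseq (d := 2) ψ hL2 fun j => hψ1 (2 * j)
  have hLφ : Tendsto ((fun k : ℕ => 2 * k) ∘ φ) atTop atTop := hL2.comp hφ.tendsto_atTop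
  -- the row at `ω`: the orbit mean of the rotated kernel words is `≤ −r`
  have hrowω := hrow ω ((fun k : ℕ => 2 * k) ∘ φ) ψ hLφ (fun j => hψ _) (fun j => hψ1 _) hω hu
  have hneg : ∑ g ∈ S, (ω.expect (d4ShiftSet g 0 Λ') (fermionEmbed (PolySite.d4Emb g 0 Λ') (-X))).re =
      -∑ g ∈ S, (ω.expect (d4ShiftSet g 0 Λ') (fermionEmbed (PolySite.d4Emb g 0 Λ') X)).re := by
    rw [← Finset.sum_neg_distrib]
    refine Finset.sum_congr rfl fun g _ => ?_
    rw [map_neg, map_neg, Complex.neg_re]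
  rw [hneg] at hrowω
  -- the orbit means along the subsequence converge to the orbit mean in `ω`
  set M : ℕ → ℝ := fun j => (S.card : ℝ)⁻¹ * ∑ g ∈ S,
      (torusAvgExpect (2 * φ j) (d4ShiftSet g 0 Λ') (fermionEmbed (PolySite.d4Emb g 0 Λ') X) (ψ (2 * φ j))).re
    with hM
  have hMlim : Tendsto M atTop (𝓝 ((S.card : ℝ)⁻¹ * ∑ g ∈ S,
      (ω.expect (d4ShiftSet g 0 Λ') (fermionEmbed (PolySite.d4Emb g 0 Λ') X)).re)) := by
    refine (tendsto_finsetSum S fun g _ => ?_).const_mul _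
    exact (Complex.continuous_re.tendsto _).comp (hω (d4ShiftSet g 0 Λ') _)
  have hMle : (S.card : ℝ)⁻¹ * ∑ g ∈ S,
      (ω.expect (d4ShiftSet g 0 Λ') (fermionEmbed (PolySite.d4Emb g 0 Λ') X)).re ≤ -((r : ℚ) : ℝ) := by
    rw [mul_neg] at hrowω
    linarith
  -- along the subsequence, the summit term is dominated by `M_j / Σ Q` (kinematics), eventually
  have hev : ∀ᶠ j : ℕ in atTop, useq (φ j) ≤ M j / qs := by
    filter_upwards [(eventually_injOn_proj_of_tendsto Λ' hLφ), hLφ.eventually_ge_atTop 3,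
      (hφ.tendsto_atTop).eventually_ge_atTop 1] with j hInj hL3 hj1
    obtain ⟨m, hm2, hterm'⟩ := hterm (φ j) hj1
    have hm2' : 2 * φ j = m + 1 := hm2
    simp only [Function.comp_apply] at hInj hL3
    rw [hterm', hM]
    dsimp only
    rw [hm2'] at hInj ⊢
    have hkin := gramSum_mul_pairFieldDensity_le_re_orbitState_pairKernelWord h1 B Q K wt v hw hQ hInj (ψ (m + 1))
    rw [re_orbitState_spaceGroupUnitary_fermionEmbed_toTorusEmb S hInj] at hkin
    simp_rw [← torusAvgExpect_eq] at hkin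
    rw [le_div_iff₀ hQpos, mul_comm]
    exact hkin
  -- hence for every `ε > 0`, frequently `useq k ≤ C + ε`
  refine le_of_forall_pos_le_add fun ε hε => ?_
  have hMev : ∀ᶠ j : ℕ in atTop, M j / qs ≤ C + ε := by
    have hlim2 : Tendsto (fun j => M j / qs) atTop
        (𝓝 (((S.card : ℝ)⁻¹ * ∑ g ∈ S,
          (ω.expect (d4ShiftSet g 0 Λ') (fermionEmbed (PolySite.d4Emb g 0 Λ') X)).re) / qs)) :=
      hMlim.div_const _
    have hlt : ((S.card : ℝ)⁻¹ * ∑ g ∈ S,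
        (ω.expect (d4ShiftSet g 0 Λ') (fermionEmbed (PolySite.d4Emb g 0 Λ') X)).re) / qs < C + ε := by
      have hle : ((S.card : ℝ)⁻¹ * ∑ g ∈ S,
          (ω.expect (d4ShiftSet g 0 Λ') (fermionEmbed (PolySite.d4Emb g 0 Λ') X)).re) / qs ≤ C := by
        rw [hC]
        exact div_le_div_of_nonneg_right hMle hQpos.le
      linarith
    exact (hlim2.eventually (gt_mem_nhds hlt)).mono fun j hj => hj.le
  have hfreq : ∃ᶠ k : ℕ in atTop, useq k ≤ C + ε := by
    have hevφ : ∀ᶠ j : ℕ in atTop, useq (φ j) ≤ C + ε := by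
      filter_upwards [hev, hMev] with j h1' h2'
      exact h1'.trans h2'
    exact hφ.tendsto_atTop.frequently hevφ.frequently
  exact liminf_le_of_frequently_le hfreq hbdd

/-- **Plain UPPER row (`S = {1}`) ⇒ the same ceiling**: `SquareTTPrimeCorrUpperRow tp U n u fu Λ_B
(pairKernelWord B Q)`, Gram taps with `0 < Σ Q`, and `energyDensityTT' 1 tp U n ≤ u` give `liminf_k u_k ≤ fu / Σ Q`
for every family of unit sector ground states. [cite: Scalapino1995, §2 eq. (2.4)] -/
theorem liminf_dWavePairFieldLRO_le_of_kernel_upperRow {tp U n : ℝ} {u fu : ℚ} {B : Finset (Site 2)}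
    {Q : Site 2 → Site 2 → ℚ} {K' : Type*} (K : Finset K') (wt : K' → ℝ) (v : K' → Site 2 → ℝ)
    (hw : ∀ k ∈ K, 0 ≤ wt k) (hQ : ∀ x ∈ B, ∀ y ∈ B, ((Q x y : ℚ) : ℝ) = ∑ k ∈ K, wt k * v k x * v k y)
    (hQpos : 0 < ∑ x ∈ B, ∑ y ∈ B, ((Q x y : ℚ) : ℝ))
    (hrow : SquareTTPrimeCorrUpperRow tp U n u fu (B.biUnion (pairRegion (insert (0 : Site 2) unitSteps)))
      (pairKernelWord (insert (0 : Site 2) unitSteps) dWaveFormFactor B Q))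
    (hu : energyDensityTT' 1 tp U n ≤ ((u : ℚ) : ℝ))
    (ψ : ∀ L, Fock (Orb (FermionTorus 2 L)))
    (hψ : ∀ L, IsGroundStateInSector (hubbardTorusTT' L 1 tp U) (rectN n L) 0 (ψ L))
    (hψ1 : ∀ L, star (ψ L) ⬝ᵥ ψ L = 1) :
    liminf (fun k : ℕ => (∑ x ∈ halfOpenBox 2 (2 * k), ∑ y ∈ halfOpenBox 2 (2 * k),
        torusPullback (pairFieldCorr dWaveFormFactor ψ) (2 * k) x y) /
          ((#(halfOpenBox 2 (2 * k)) : ℝ)) ^ 2) atTop ≤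
      ((fu : ℚ) : ℝ) / ∑ x ∈ B, ∑ y ∈ B, ((Q x y : ℚ) : ℝ) := by
  have hlow : SquareTTPrimeCorrLowerRow tp U n u (-fu) (B.biUnion (pairRegion (insert (0 : Site 2) unitSteps)))
      (-pairKernelWord (insert (0 : Site 2) unitSteps) dWaveFormFactor B Q) :=
    SquareTTPrimeCorrLowerRow.of_upper_neg (by rw [neg_neg, neg_neg]; exact hrow)
  have horb := (squareTTPrimeCorrOrbitLowerRow_singleton_one_iff).2 hlow
  have h := liminf_dWavePairFieldLRO_le_of_kernel_orbitLowerRow_neg (Finset.mem_singleton_self _) K wt v hw hQ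
    hQpos horb hu ψ hψ hψ1
  push_cast at h
  rw [neg_neg] at h
  exact h

/-- **M3′ form, ORBIT row** (`U = 8`, `n = 7/8`, hopping `tp`): `M3CorrOrbitLowerRow tp u r S Λ_B (−pairKernelWord B Q)`
with Gram taps, `0 < Σ Q`, and the cap discharged by `M3EnergyUpperRow tp hi`, `hi ≤ u`, gives
`liminf_k u_k ≤ −r / Σ Q` for EVERY family of unit `(rectN (7/8) L, S^z = 0)`-sector ground states.
HONEST: a ceiling; says nothing about the presence of pairing. [cite: Scalapino1995, §2 eq. (2.4)] -/
theorem m3_liminf_dWavePairFieldLRO_le_of_kernel_orbitLowerRow_neg {tp : ℝ} {u hi r : ℚ}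
    {S : Finset (DihedralGroup 4)} (h1 : (1 : DihedralGroup 4) ∈ S) {B : Finset (Site 2)}
    {Q : Site 2 → Site 2 → ℚ} {K' : Type*} (K : Finset K') (wt : K' → ℝ) (v : K' → Site 2 → ℝ)
    (hw : ∀ k ∈ K, 0 ≤ wt k) (hQ : ∀ x ∈ B, ∀ y ∈ B, ((Q x y : ℚ) : ℝ) = ∑ k ∈ K, wt k * v k x * v k y)
    (hQpos : 0 < ∑ x ∈ B, ∑ y ∈ B, ((Q x y : ℚ) : ℝ))
    (hrow : M3CorrOrbitLowerRow tp u r S (B.biUnion (pairRegion (insert (0 : Site 2) unitSteps)))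
      (-pairKernelWord (insert (0 : Site 2) unitSteps) dWaveFormFactor B Q))
    (hE : M3EnergyUpperRow tp hi) (hhi : hi ≤ u)
    (ψ : ∀ L, Fock (Orb (FermionTorus 2 L)))
    (hψ : ∀ L, IsGroundStateInSector (hubbardTorusTT' L 1 tp 8) (rectN (7 / 8) L) 0 (ψ L))
    (hψ1 : ∀ L, star (ψ L) ⬝ᵥ ψ L = 1) :
    liminf (fun k : ℕ => (∑ x ∈ halfOpenBox 2 (2 * k), ∑ y ∈ halfOpenBox 2 (2 * k),
        torusPullback (pairFieldCorr dWaveFormFactor ψ) (2 * k) x y) /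
          ((#(halfOpenBox 2 (2 * k)) : ℝ)) ^ 2) atTop ≤
      -((r : ℚ) : ℝ) / ∑ x ∈ B, ∑ y ∈ B, ((Q x y : ℚ) : ℝ) :=
  liminf_dWavePairFieldLRO_le_of_kernel_orbitLowerRow_neg h1 K wt v hw hQ hQpos hrow
    ((show energyDensityTT' 1 tp 8 (7 / 8) ≤ ((hi : ℚ) : ℝ) from hE).trans (by exact_mod_cast hhi)) ψ hψ hψ1

/-- **M3′ form, plain UPPER row**: `M3CorrUpperRow tp u fu Λ_B (pairKernelWord B Q)` + Gram taps + `M3EnergyUpperRow tp hi`,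
`hi ≤ u` ⇒ `liminf_k u_k ≤ fu / Σ Q` for every family of unit sector ground states. [cite: Scalapino1995, §2 eq. (2.4)] -/
theorem m3_liminf_dWavePairFieldLRO_le_of_kernel_upperRow {tp : ℝ} {u hi fu : ℚ} {B : Finset (Site 2)}
    {Q : Site 2 → Site 2 → ℚ} {K' : Type*} (K : Finset K') (wt : K' → ℝ) (v : K' → Site 2 → ℝ)
    (hw : ∀ k ∈ K, 0 ≤ wt k) (hQ : ∀ x ∈ B, ∀ y ∈ B, ((Q x y : ℚ) : ℝ) = ∑ k ∈ K, wt k * v k x * v k y)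
    (hQpos : 0 < ∑ x ∈ B, ∑ y ∈ B, ((Q x y : ℚ) : ℝ))
    (hrow : M3CorrUpperRow tp u fu (B.biUnion (pairRegion (insert (0 : Site 2) unitSteps)))
      (pairKernelWord (insert (0 : Site 2) unitSteps) dWaveFormFactor B Q))
    (hE : M3EnergyUpperRow tp hi) (hhi : hi ≤ u)
    (ψ : ∀ L, Fock (Orb (FermionTorus 2 L)))
    (hψ : ∀ L, IsGroundStateInSector (hubbardTorusTT' L 1 tp 8) (rectN (7 / 8) L) 0 (ψ L))
    (hψ1 : ∀ L, star (ψ L) ⬝ᵥ ψ L = 1) :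
    liminf (fun k : ℕ => (∑ x ∈ halfOpenBox 2 (2 * k), ∑ y ∈ halfOpenBox 2 (2 * k),
        torusPullback (pairFieldCorr dWaveFormFactor ψ) (2 * k) x y) /
          ((#(halfOpenBox 2 (2 * k)) : ℝ)) ^ 2) atTop ≤
      ((fu : ℚ) : ℝ) / ∑ x ∈ B, ∑ y ∈ B, ((Q x y : ℚ) : ℝ) :=
  liminf_dWavePairFieldLRO_le_of_kernel_upperRow K wt v hw hQ hQpos hrow
    ((show energyDensityTT' 1 tp 8 (7 / 8) ≤ ((hi : ℚ) : ℝ) from hE).trans (by exact_mod_cast hhi)) ψ hψ hψ1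

end Row

end Summit.Ventures.CertifiedManyBodySolver.Observables

end
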